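import Summits.BirchSwinnertonDyer.BirchSwinnertonDyer.Theses.TameQuarticManinParity
import Summits.BirchSwinnertonDyer.Rank1Residual.O5.CharTwistThreeIsometry
import HarnessLib

/-!
# Route `TameQuarticManinParity`, G46 (LINE 46 glue): `CuspRegularOfStrictCharTwist → StrictRegularTracesGenerate → CuspRegularTraceTwistTransfer` — glue item stmt-BirchSwinnertonDyer-24740 `TraceTwistTransferOfStrict`, BY NAME

Verbatim landing (leaf hand `leafhand-bsd-tamequarticmaninpa-1-g0`, cone of the cruxes 23736/23737, announced on the
bsd-eis STATUS before proposing) of the planner-of-record's kernel-checked glue, HOME `ideators/bsd-idea-3/ideas/l46/Sketch46.lean sha16 f9c66002907bab51 (bsd-idea-3 g13, 2026-08-29T14:02Z)`;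
there the route items were shadow `def`s (pre-render), here the theorem is stated against the rendered route decls
(route rev 87) — the proof script is the pen's, unchanged unless noted.  Glue only: the children and every crux above
stay OPEN; no summit is proved; BSD is NOT proved; Manin's conjecture is not proved.
-/

set_option autoImplicit false
-- D-0017: single-problem summit, so `Summit.BirchSwinnertonDyer.BirchSwinnertonDyer.…` repeats a namespace BY DESIGN.
set_option linter.dupNamespace false
open Summit.BirchSwinnertonDyer.BirchSwinnertonDyer.Theses.TameQuarticManinParity
open Literature.NumberTheory.EllipticCurves.ModularForms CongruenceSubgroup
open Summit.BirchSwinnertonDyer.Rank1Residual.O5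
open scoped MatrixGroups ModularForm

namespace Summit.BirchSwinnertonDyer.BirchSwinnertonDyer.Theorems.TameQuarticManinParity

/-- **LINE 46 glue.** `⟨Rf, g⟩ = ⟨R(Rf), Rg⟩ = ⟨f, Rg⟩` (isometry on the depleted form `Rf`, `R(Rf) = f`),
`⟨Rf, Rf⟩ = ⟨f, f⟩`; MS46 for `Rf` reduces to strict `g`, and for strict `g` the twist `Rg` is rational and
cusp-regular (TD46), so the hypothesis on `f` applies to `Rg`. -/
theorem traceTwistTransfer_of_strict : TraceTwistTransferOfStrict := by
  intro hTD hMS N _ hv2 h9 χ hχ hprim f hnew hnewR hfq hdep c hH g hgq hgreg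
  -- `Rf` is depleted, rational, and `R(Rf) = f`
  have hdepR : ∀ n : ℕ, 3 ∣ n → cuspCoeff (charTwist N (dvd_refl _) h9 hχ f) n = 0 :=
    fun n hn ↦ cuspCoeff_charTwist_eq_zero_of_dvd h9 hχ hprim f hn
  have hRR : charTwist N (dvd_refl _) h9 hχ (charTwist N (dvd_refl _) h9 hχ f) = f :=
    charTwist_charTwist h9 hχ hprim hdep
  have hratR : ∀ (x : CuspForm (Gamma0 N) 2), (∀ n : ℕ, ∃ q : ℚ, (q : ℂ) = cuspCoeff x n) →
      ∀ n : ℕ, ∃ q : ℚ, (q : ℂ) = cuspCoeff (charTwist N (dvd_refl _) h9 hχ x) n := by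
    intro x hx n
    obtain ⟨q, hq⟩ := hx n
    obtain ⟨z, hz⟩ := exists_intCast_eq_chi_apply hχ (n : ZMod 3)
    refine ⟨z * q, ?_⟩
    rw [cuspCoeff_charTwist _ _ _ hχ hprim, ← hq, ← hz]
    push_cast; ring
  have hRfq := hratR f hfq
  have hnewRR : IsNewform0 (charTwist N (dvd_refl _) h9 hχ (charTwist N (dvd_refl _) h9 hχ f)) := by
    rw [hRR]; exact hnew
  -- isometry `⟨Rf, Rf⟩ = ⟨f, f⟩`
  have hiso : peterssonProduct (Gamma0 N) 2 (charTwist N (dvd_refl _) h9 hχ f)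
      (charTwist N (dvd_refl _) h9 hχ f) = peterssonProduct (Gamma0 N) 2 f f :=
    peterssonProduct_charTwist_charTwist h9 hχ hprim hdep f
  -- reduce to strict `g` via MS46 applied to `Rf`
  refine hMS N hv2 h9 χ hχ hprim (charTwist N (dvd_refl _) h9 hχ f) hnewR hnewRR hRfq hdepR c ?_ g hgq hgreg
  intro g' hg'q hg'reg hg'str
  -- adjointness from the isometry on the depleted form `Rf`
  have hadj : peterssonProduct (Gamma0 N) 2 (charTwist N (dvd_refl _) h9 hχ f) g' =
      peterssonProduct (Gamma0 N) 2 f (charTwist N (dvd_refl _) h9 hχ g') := by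
    rw [← peterssonProduct_charTwist_charTwist h9 hχ hprim hdepR g', hRR]
  have hRg'reg := hTD N hv2 h9 χ hχ hprim g' hg'q hg'reg hg'str
  obtain ⟨t, ht0, ht⟩ := hH (charTwist N (dvd_refl _) h9 hχ g') (hratR g' hg'q) hRg'reg
  exact ⟨t, ht0, by rw [hadj, ht, hiso]⟩

end Summit.BirchSwinnertonDyer.BirchSwinnertonDyer.Theorems.TameQuarticManinParity
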